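import Mathlib
import HarnessLib
import Literature.MathematicalPhysics.QuantumLattice.DWaveOrderParameterProofs
import Summits.HubbardSuperconductivity.HubbardSuperconductivity.Theorems.WeakCouplingBCSWcbcsBcsConstructionInteractionComparison
import Summits.HubbardSuperconductivity.HubbardSuperconductivity.Theorems.WeakCouplingBCSWcbcsBcsConstructionFreeSourcedGroundEnergy
import Summits.HubbardSuperconductivity.HubbardSuperconductivity.Theorems.WeakCouplingBCSWcbcsBcsConstructionDWaveCooperSumLowerBound

/-!
# Route `WeakCouplingBCS` — crux `WcbcsBcsConstruction` (stmt-HubbardSuperconductivity-2010),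
# line `lro-seed-kink-bridge`, stub `stub_freeStairsFloor`

**The top stairs are free-gas stairs.** With `D_L(U,h) = dWaveSourceDensity L U μ h` the tracial
ground-state `d`-wave pair density of the sourced grand-canonical Hubbard torus
`dWaveSourceTorus L U μ h` on `(ℤ/Lℤ)²`: for chemical potentials in a compact `[μ₁, μ₂] ⊂ (-4, 0)` there
are `c, h₀ > 0` such that for all `h ∈ (0, h₀)`, `μ ∈ [μ₁, μ₂]` and `U ≥ 0`,

`c · h · log(1/h) - U/h ≤ liminf_L D_{L+1}(U, h)`,

i.e. every stair `F_U(h) = liminf_L D_{L+1}(U,h)` of the Koma–Tasaki `d`-wave order parameter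
`dWaveOrderParameter U μ = inf_{h>0} F_U(h)` is at least the FREE Cooper-logarithmic response minus the
price `U/h` of the repulsion; in particular the crux's floor `e^{-C/U²} ≤ F_U(h)` is automatic for
`h ≳ √(U / log(1/U))`.

Proof (assembly of three landed stubs of the line; Koma–Tasaki 1994, §1 for the set-up).
(1) Interaction comparison (`stub_interactionComparison` with the couplings `0 ≤ U` and `r = h/2`):
`D_L(U,h) ≥ D_L(0,h/2) - U/h`.
(2) Energy form at `U = 0` (`energyGain_div_le_dWaveSourceDensity`):
`D_L(0,h/2) ≥ (E_L(0) - E_L(h/2)) / (h L²)`, `E_L(s) = E₀(dWaveSourceTorus L 0 μ s)`.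
(3) The free sourced ground energy in BdG form (`stub_freeSourcedGroundEnergy`, `L ≥ 3`):
`E_L(0) - E_L(h/2) = Σ_k (√(ξ_k² + 2h²ĝ_k²) - |ξ_k|)`, `ξ_k = ε_L(k) - μ`, `ĝ_k = ĝ_d(k)`.
(4) Per mode, with `ĝ_k² ≤ 4`: `√(ξ² + 2h²ĝ²) - |ξ| ≥ 2h²ĝ²/(2√(ξ² + 8h²)) = h² ĝ²/√(ξ² + (2√2h)²)`.
(5) The `d`-wave Cooper logarithm on the torus (`stub_dWaveCooperSumLowerBound` at `h' = 2√2 h`):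
`Σ_k ĝ_k²/√(ξ_k² + h'²) ≥ c₅ log(1/h') L²` eventually in `L`, and `log(1/(2√2h)) ≥ ½ log(1/h)` for
`h ≤ 1/8`. Hence `D_L(U,h) ≥ (c₅/2) h log(1/h) - U/h` eventually in `L`, and `le_liminf_of_le`
(the densities are bounded, `dWaveSourceDensity_le_const`) concludes with `c = c₅/2`,
`h₀ = min(h₅/4, 1/8)`.
-/

noncomputable section

set_option linter.dupNamespace false

namespace Summit.HubbardSuperconductivity.HubbardSuperconductivity.Theorems

open Literature.MathematicalPhysics.QuantumLattice Literature.Probability.LatticeModels Matrix Filter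
open scoped Matrix.Norms.L2Operator ComplexOrder Topology

/-! ### Elementary inequalities -/

/-- `ĝ_d(k)² ≤ 4` for the `d_{x²-y²}` form factor `cos k₁ - cos k₂`. [folklore] -/
theorem freeStairs_dWaveGap_sq_le_four {L : ℕ} (k : TorusSite 2 L) : dWaveGap k ^ 2 ≤ 4 := by
  rw [dWaveGap]
  have h1 := Real.abs_cos_le_one (latticeMomentum L k 0)
  have h2 := Real.abs_cos_le_one (latticeMomentum L k 1)
  have h : |Real.cos (latticeMomentum L k 0) - Real.cos (latticeMomentum L k 1)| ≤ 2 :=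
    (abs_sub _ _).trans (by linarith)
  rw [abs_le] at h
  nlinarith [h.1, h.2]

/-- **The per-mode BdG gain against the regulated Cooper weight**: for `x ≥ 0`, `0 ≤ A ≤ B`, `0 < B`,
`A / (2√(x + B)) ≤ √(x + A) - √x` (rationalise: `√(x+A) - √x = A/(√(x+A) + √x)` and
`√(x+A) + √x ≤ 2√(x+B)`). [folklore] -/
theorem freeStairs_div_two_sqrt_le_sqrt_sub_sqrt {x A B : ℝ} (hx : 0 ≤ x) (hA : 0 ≤ A) (hAB : A ≤ B)
    (hB : 0 < B) : A / (2 * Real.sqrt (x + B)) ≤ Real.sqrt (x + A) - Real.sqrt x := by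
  have hT : 0 < Real.sqrt (x + B) := Real.sqrt_pos.2 (by linarith)
  rw [div_le_iff₀ (by positivity)]
  have hS2 : Real.sqrt (x + A) ^ 2 = x + A := Real.sq_sqrt (by linarith)
  have hs2 : Real.sqrt x ^ 2 = x := Real.sq_sqrt hx
  have hs0 : 0 ≤ Real.sqrt x := Real.sqrt_nonneg x
  have hSs : Real.sqrt x ≤ Real.sqrt (x + A) := Real.sqrt_le_sqrt (by linarith)
  have hTS : Real.sqrt (x + A) ≤ Real.sqrt (x + B) := Real.sqrt_le_sqrt (by linarith)
  have key : 0 ≤ (Real.sqrt (x + A) - Real.sqrt x) *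
      (2 * Real.sqrt (x + B) - Real.sqrt (x + A) - Real.sqrt x) :=
    mul_nonneg (sub_nonneg.2 hSs) (by linarith)
  nlinarith [key, hS2, hs2]

/-- **The per-mode gain of the free sourced torus at source `h/2`** dominates `h²` times the `d`-wave
Cooper weight regulated at `2√2 h`: with `ĝ² ≤ 4`,
`h² ĝ²/√(ξ² + (2√2h)²) ≤ √(ξ² + (2√2(h/2)ĝ)²) - √(ξ² + (2√2·0·ĝ)²)`. [folklore] -/
theorem freeStairs_mode_gain_ge {ξ g h : ℝ} (hh : 0 < h) (hg : g ^ 2 ≤ 4) :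
    h ^ 2 * (g ^ 2 / Real.sqrt (ξ ^ 2 + (2 * Real.sqrt 2 * h) ^ 2)) ≤
      Real.sqrt (ξ ^ 2 + (2 * Real.sqrt 2 * (h / 2) * g) ^ 2) -
        Real.sqrt (ξ ^ 2 + (2 * Real.sqrt 2 * 0 * g) ^ 2) := by
  have hsqrt : Real.sqrt 2 ^ 2 = 2 := Real.sq_sqrt zero_le_two
  have hA : (2 * Real.sqrt 2 * (h / 2) * g) ^ 2 = 2 * h ^ 2 * g ^ 2 := by
    rw [mul_pow, mul_pow, mul_pow, hsqrt]; ring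
  have hB : (2 * Real.sqrt 2 * h) ^ 2 = 8 * h ^ 2 := by
    rw [mul_pow, mul_pow, hsqrt]; ring
  have h0 : ξ ^ 2 + (2 * Real.sqrt 2 * 0 * g) ^ 2 = ξ ^ 2 := by ring
  rw [hA, hB, h0]
  have hh2 : 0 < h ^ 2 := by positivity
  have key := freeStairs_div_two_sqrt_le_sqrt_sub_sqrt (x := ξ ^ 2) (A := 2 * h ^ 2 * g ^ 2)
    (B := 8 * h ^ 2) (sq_nonneg ξ) (by positivity) (by nlinarith) (by positivity)
  refine le_trans (le_of_eq ?_) key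
  rw [mul_div_assoc']
  field_simp

/-- **Summed form**:
`h² Σ_k ĝ_k²/√(ξ_k² + (2√2h)²) ≤ Σ_k (ξ_k - √(ξ_k² + (2√2·0·ĝ_k)²)) - Σ_k (ξ_k - √(ξ_k² + (2√2(h/2)ĝ_k)²))`,
the right-hand side being `E_L(0) - E_L(h/2)` in the BdG form of `stub_freeSourcedGroundEnergy`.
[folklore] -/
theorem freeStairs_sum_gain_ge {ι : Type*} [Fintype ι] (ξ g : ι → ℝ) {h : ℝ} (hh : 0 < h)
    (hg : ∀ k, g k ^ 2 ≤ 4) :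
    h ^ 2 * ∑ k, g k ^ 2 / Real.sqrt (ξ k ^ 2 + (2 * Real.sqrt 2 * h) ^ 2) ≤
      ∑ k, (ξ k - Real.sqrt (ξ k ^ 2 + (2 * Real.sqrt 2 * 0 * g k) ^ 2)) -
        ∑ k, (ξ k - Real.sqrt (ξ k ^ 2 + (2 * Real.sqrt 2 * (h / 2) * g k) ^ 2)) := by
  rw [← Finset.sum_sub_distrib, Finset.mul_sum]
  refine Finset.sum_le_sum fun k _ => ?_
  have := freeStairs_mode_gain_ge (ξ := ξ k) hh (hg k)
  linarith

/-- `log(1/(2√2 h)) ≥ ½ log(1/h)` for `0 < h ≤ 1/8` (since `(2√2)² = 8 ≤ 1/h`). [folklore] -/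
theorem freeStairs_log_rescale {h : ℝ} (hh : 0 < h) (hh8 : h ≤ 1 / 8) :
    Real.log (1 / h) / 2 ≤ Real.log (1 / (2 * Real.sqrt 2 * h)) := by
  have hsqrt : Real.sqrt 2 ^ 2 = 2 := Real.sq_sqrt zero_le_two
  have hs0 : 0 < Real.sqrt 2 := Real.sqrt_pos.2 zero_lt_two
  have hpos : 0 < 1 / (2 * Real.sqrt 2 * h) := by positivity
  -- compare the squares: `(1/(2√2h))² = 1/(8h²) ≥ 1/h`
  have hsq : 1 / h ≤ (1 / (2 * Real.sqrt 2 * h)) ^ 2 := by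
    rw [div_pow, mul_pow, mul_pow, hsqrt, one_pow, div_le_div_iff₀ hh (by positivity)]
    nlinarith
  have hlog := Real.log_le_log (by positivity) hsq
  rw [Real.log_pow] at hlog
  push_cast at hlog
  linarith

/-! ### The finite-volume floor -/

/-- **Finite-volume free-stairs floor.** If `L ≥ 3`, `0 < h`, `0 ≤ U` and the regulated `d`-wave Cooper
sum at `h' = 2√2 h` satisfies `c₅ log(1/h') L² ≤ Σ_k ĝ_k²/√(ξ_k² + h'²)`, then
`c₅ h log(1/h') - U/h ≤ D_L(U,h)` (interaction comparison at `r = h/2`, energy form at `U = 0`,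
BdG ground energy, per-mode gain bound). [cite: KomaTasaki1994, §1] -/
theorem freeStairs_finiteVolume_floor (L : ℕ) [NeZero L] (hL : 3 ≤ L) {U μ h c₅ : ℝ} (hh : 0 < h)
    (hU : 0 ≤ U)
    (hsum : c₅ * Real.log (1 / (2 * Real.sqrt 2 * h)) * (L : ℝ) ^ 2 ≤
      ∑ k : TorusSite 2 L, dWaveGap k ^ 2 /
        Real.sqrt ((torusBand L k - μ) ^ 2 + (2 * Real.sqrt 2 * h) ^ 2)) :
    c₅ * h * Real.log (1 / (2 * Real.sqrt 2 * h)) - U / h ≤ dWaveSourceDensity L U μ h := by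
  have hN := cast_sq_pos_of_neZero L
  -- (1) interaction comparison with couplings `0 ≤ U`, shift `r = h/2`
  have i1 := (stub_interactionComparison L 0 U μ h (h / 2) hU (by positivity)).1
  have e1 : h - h / 2 = h / 2 := by ring
  have e2 : (U - 0) / (2 * (h / 2)) = U / h := by
    rw [sub_zero]
    congr 1
    ring
  rw [e1, e2] at i1
  -- (2) energy form at `U = 0`, source `h/2`
  have i2 := energyGain_div_le_dWaveSourceDensity (L := L) 0 μ (h := h / 2) (by positivity)
  have hpos : (0 : ℝ) < 2 * (h / 2) * (L : ℝ) ^ 2 := by positivity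
  rw [div_le_iff₀ hpos] at i2
  -- (3) BdG form of the free sourced ground energies and (4) the per-mode gain bound
  have i3 := freeStairs_sum_gain_ge (fun k : TorusSite 2 L => torusBand L k - μ) (fun k => dWaveGap k)
    hh (fun k => freeStairs_dWaveGap_sq_le_four k)
  rw [← stub_freeSourcedGroundEnergy L hL μ 0, ← stub_freeSourcedGroundEnergy L hL μ (h / 2)] at i3
  -- chain: `c₅ h log(1/h') · (hL²) ≤ h² Σ ≤ E(0) - E(h/2) ≤ D_L(0,h/2) · (hL²)`
  have i4 : c₅ * h * Real.log (1 / (2 * Real.sqrt 2 * h)) * (2 * (h / 2) * (L : ℝ) ^ 2) ≤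
      dWaveSourceDensity L 0 μ (h / 2) * (2 * (h / 2) * (L : ℝ) ^ 2) := by
    calc c₅ * h * Real.log (1 / (2 * Real.sqrt 2 * h)) * (2 * (h / 2) * (L : ℝ) ^ 2)
        = h ^ 2 * (c₅ * Real.log (1 / (2 * Real.sqrt 2 * h)) * (L : ℝ) ^ 2) := by ring
      _ ≤ h ^ 2 * ∑ k : TorusSite 2 L, dWaveGap k ^ 2 /
            Real.sqrt ((torusBand L k - μ) ^ 2 + (2 * Real.sqrt 2 * h) ^ 2) :=
          mul_le_mul_of_nonneg_left hsum (by positivity)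
      _ ≤ (dWaveSourceTorus L 0 μ 0).groundEnergy - (dWaveSourceTorus L 0 μ (h / 2)).groundEnergy := i3
      _ ≤ dWaveSourceDensity L 0 μ (h / 2) * (2 * (h / 2) * (L : ℝ) ^ 2) := i2
  have i5 := le_of_mul_le_mul_right i4 hpos
  linarith

/-! ### The stub -/

/-- **Stub `stub_freeStairsFloor`** of the line `lro-seed-kink-bridge` (crux `WcbcsBcsConstruction`):
the top stairs are free-gas stairs. For chemical potentials in a compact `[μ₁, μ₂] ⊂ (-4, 0)` there are
`c, h₀ > 0` such that for all `h ∈ (0, h₀)`, `μ ∈ [μ₁, μ₂]` and `U ≥ 0`,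
`c h log(1/h) - U/h ≤ liminf_L dWaveSourceDensity (L+1) U μ h`: the sourced `d`-wave pair density at
repulsion `U` is at least the free Cooper-logarithmic response minus `U/h` (interaction comparison
`D(U,h) ≥ D(0,h/2) - U/h`, the energy form at `U = 0`, the BdG free sourced ground energy and the `d`-wave
Cooper logarithm on the torus at the regulator `2√2 h`). [cite: KomaTasaki1994, §1] -/
theorem stub_freeStairsFloor :
    ∀ μ₁ μ₂ : ℝ, -4 < μ₁ → μ₁ ≤ μ₂ → μ₂ < 0 → ∃ c : ℝ, 0 < c ∧ ∃ h₀ : ℝ, 0 < h₀ ∧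
      ∀ h ∈ Set.Ioo 0 h₀, ∀ μ ∈ Set.Icc μ₁ μ₂, ∀ U : ℝ, 0 ≤ U →
        c * h * Real.log (1 / h) - U / h ≤
          liminf (fun L : ℕ => dWaveSourceDensity (L + 1) U μ h) atTop := by
  intro μ₁ μ₂ hμ₁ hμ₁₂ hμ₂
  obtain ⟨c₅, hc₅, h₅, hh₅, H⟩ := stub_dWaveCooperSumLowerBound μ₁ μ₂ hμ₁ hμ₁₂ hμ₂
  refine ⟨c₅ / 2, by positivity, min (h₅ / 4) (1 / 8), lt_min (by positivity) (by norm_num), ?_⟩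
  intro h hh μ hμ U hU
  have hh0 : 0 < h := hh.1
  have hh4 : h < h₅ / 4 := lt_of_lt_of_le hh.2 (min_le_left _ _)
  have hh8 : h ≤ 1 / 8 := (lt_of_lt_of_le hh.2 (min_le_right _ _)).le
  -- the rescaled regulator `h' = 2√2 h ∈ (0, h₅)`
  have hs0 : 0 < Real.sqrt 2 := Real.sqrt_pos.2 zero_lt_two
  have hs2 : Real.sqrt 2 < 2 := by
    rw [show (2 : ℝ) = Real.sqrt 4 by
      rw [show (4 : ℝ) = 2 ^ 2 by norm_num, Real.sqrt_sq (by norm_num : (0 : ℝ) ≤ 2)]]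
    exact Real.sqrt_lt_sqrt (by norm_num) (by norm_num)
  have hh' : 2 * Real.sqrt 2 * h ∈ Set.Ioo 0 h₅ := by
    refine ⟨by positivity, ?_⟩
    nlinarith
  obtain ⟨L₀, hL₀⟩ := H (2 * Real.sqrt 2 * h) hh' μ hμ
  -- the rescaled logarithm
  have hlog := freeStairs_log_rescale hh0 hh8
  -- eventually in `L`, the finite-volume floor
  refine le_liminf_of_le (isCoboundedUnder_ge_of_le atTop fun L => dWaveSourceDensity_le_const _ U μ h) ?_
  rw [eventually_atTop]
  refine ⟨max L₀ 2, fun L hL => ?_⟩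
  have hL3 : 3 ≤ L + 1 := by have := le_of_max_le_right hL; omega
  have hLL₀ : L₀ ≤ L + 1 := by have := le_of_max_le_left hL; omega
  have key := freeStairs_finiteVolume_floor (L + 1) hL3 (μ := μ) (c₅ := c₅) hh0 hU (hL₀ (L + 1) hLL₀)
  have hmono : c₅ / 2 * h * Real.log (1 / h) ≤ c₅ * h * Real.log (1 / (2 * Real.sqrt 2 * h)) := by
    have := mul_le_mul_of_nonneg_left hlog (le_of_lt (mul_pos hc₅ hh0))
    linarith
  linarith

end Summit.HubbardSuperconductivity.HubbardSuperconductivity.Theorems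

end
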